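/-
Copyright: public-audit package `pub-balaban` (b2b-balaban), seat pv16-g10. Released under Apache 2.0 like Mathlib.
-/
import Literature.MathematicalPhysics.QuantumFieldTheory.Balaban1983to89.T4CondLawRelative

/-!
# T4TiltModulusRelative — the tilt modulus of the model conditional law for INSERTS READING THE RELATIVE FIBRE
# VARIABLE ALONE (`B′ = (1/i) log V′`): in Bałaban's relative coordinates the (B-INS) background-variation term of
# `T4CondLawRelative.norm_integral_condLaw_sub_le_relative` is ABSENT, and `T4TiltModulus` §3 (the `MeanLipschitz` /
# `CondMeanSuppression` / pair-mean dischargers) holds verbatim on the RELATIVE tilt domain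
# (cell `pub-balaban`, T4-DAG v10 §5, row O3.E-i′ (β); self-proposed kernel sub-row T4-O3.E-i′-β-RELTILT* of the pv16
# lineage (gen 10) = owner of `T4FirstOrderSize.MeanLipschitz` and `T4TiltModulus`; kernel bookkeeping, Mathlib + cell
# modules BY NAME)

HONEST FRAMING (cell `pub-balaban`, T4-DAG v10).  The cell's T4 target is the existence AND uniqueness of the continuum
limit of Bałaban's unit-scale averaged loop expectations on a finite torus — NOT the Yang–Mills mass gap, NOT the Clay
problem.  This module proves ELEMENTARY MEASURE THEORY about the cell's OWN model of "`E_t[· | V_out]`"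
(`T4DressingDefect.condLaw s old V`, pv04) and nothing else.  THE LOCATED QUESTION it settles (GAPS G-pv16g9-2 caveat
(c1); pv04-g10's kernel answer `T4CondLawRelative` (p182861) with its recorded price (D); advisory G-pv12g9-1 (r3)):
pv04-g10 showed that the tilt hypothesis (S-TILT) of `T4TiltModulus` has to be posed on the RELATIVE fibre densities
(`FibreRatioClose s (relDensity s vΛ old) u u₀ κ ε` — there a window reading `V′` alone is exterior-blind), at the price
of an additional (B-INS)-type input `D ≥ sup_{y′} ‖F(y′·vΛ(u)⌈_s) − F(y′·vΛ(u₀)⌈_s)‖` for an insert `F` FIXED IN THE RAW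
fibre variable, which the relative reading sees through the moving background.  But the insert of the node this modulus
serves — the conditional mean of the FLUCTUATION FIELD of row O3.E-i′ (β), «B′ = (1/i) log V′» ([I] p. 265) — is NOT
fixed in the raw variable: it is a function of the RELATIVE variable `V′ = V(V^{(k)})⁻¹` ALONE, exactly like the
printed windows.  For such RELATIVE INSERTS (`relInsert s vΛ f u : y ↦ f(y·(vΛ u)⌈_s⁻¹)`, §1) the change of variables
of `T4CondLawRelative` makes the insert EXTERIOR-INDEPENDENT (`integral_condLaw_relInsert`:
`∫ relInsert f u d(condLaw s old u) = ∫ f d(condLaw s (relDensity s vΛ old) u)`), so the tilt modulus holds WITH NO `D`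
TERM (`norm_integral_condLaw_relInsert_sub_le`: `‖∫relInsert f u ∂condLaw s old u − ∫relInsert f u₀ ∂condLaw s old u₀‖
≤ (e^{2ε} − 1)·M`), and the three dischargers of `T4TiltModulus` §3 hold VERBATIM on the relative tilt domain
`tiltDom s (relDensity s vΛ old) u₀ κ ε ε₀` with the SAME constant `lip = 2e^{2ε₀}M` (§4: `meanLipschitz_of_relTilt`,
`condMeanSuppression_of_relTilt`, `pairMeanField_lipschitz_of_relTilt`, `pairMeanField_norm_le_of_relTilt`).  In one
sentence: posed consistently in Bałaban's relative coordinates — density, window AND insert all reading `V′` — the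
(β)-node costs exactly the one oscillation input `ε` of (LOG), as in the raw toy reading `vΛ ≡ 1` (`relInsert_one`,
`tiltDom_relDensity_one`); a (B-INS) charge is owed only by inserts genuinely fixed in the raw variable (§4
`meanLipschitz_of_relTilt_raw`, `lip = 2e^{2ε₀}M + L`, pv04's theorem BY NAME).  All hypotheses are on the RAW density
`old` (measurable, `0 ≤ old ≤ C`, printed proviso `fibreIntegral ≠ 0` at `u₀`) and on `FieldIndep s vΛ`; NO
measurability of the background `vΛ` is needed (§2 re-derives the fibre-level facts of `T4TiltModulus` §2 for the
relative law from right invariance, as pv04-g10 did inside one proof).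

WHAT IS NOT CLAIMED.  Nothing printed by Bałaban is asserted or used: not that the backgrounds `V^{(k)} = M_k(U_{k+1})`
([I] (2.3) p. 265) / `V_Λ = M^k(U₀)` ([IV] p. 197) exist, are unique, measurable or fibre-independent (U1a / B12-side
inputs of the DAG; here only the hypothesis SHAPE `FieldIndep`); not that any printed density has the Gibbs form of §5;
NO estimate of the oscillation `ε(u)` or of the free constant `κ(u)` — the (LOG) input, typed for the Wilson exponent in
RAW coordinates by the pv28 lineage (`T4TiltOscillation`, p182912) and claimed by it in RELATIVE coordinates
(G7-LOGREL*), whose membership theorems for `tiltDom s (relDensity s vΛ old) u₀ κ ε ε₀` this module is built to CONSUME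
BY NAME; not `MeanVanishes` / zero pair mean at the reference exterior (row O3.E-i′ (α)/K: `T4AdInvariant`,
`T4CoReadAxialCondLaw`); the δ-function factors and gauge-fixing graphs of the printed laws stay outside the density
model (DIVERGENCE F7 / D-f2.8 / D-pv16.2 / D-pv16.5 / D-pv16.6: the printed `B′` enters through further maps,
`H_k(B′)` etc., and `relInsert` is ANY function of `V′⌈_s`).  Value = kernel certificate that the (B-INS) charge of the
relative reading is void for the (β)-node's own insert, NOT summit progress.

CITATION HEADER (lean-in-tree rule 2026-08-18).  T. Bałaban, *Renormalization group approach to lattice gauge field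
theories. I*, Comm. Math. Phys. **109**, 249–301 (1987) [Balaban1987RG1] (cell paper B12 = [I]; held text
`paper:balaban1987-cmp109-rg-i-small-field`, journal page = PDF page + 248); T. Bałaban, *Large field renormalization.
I. The basic step of the 𝐑 operation*, Comm. Math. Phys. **122**, 175–202 (1989) [Balaban1989LargeFieldI] (B15 =
[IV]; held `paper:balaban1989-cmp122-large-field-i`, journal page = PDF page + 174).  Both are manuscripts UNDER
ADJUDICATION by the audit cell; they are quoted for the SHAPE of a change of variables only («…» re-checked this
generation against the held texts with `lit read … --grep`: PDF p0017 L28–L33 resp. p0027 L15–L24), never as facts.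

WHAT IS PRINTED (the shape only).
* [I] p. 265 (held text p0017 L28–L33): «We introduce new integration variables V′ = V(V^{(k)})^{−1}, or V = V′V^{(k)},
  and we assume that the characteristic function χ_k and the δ-functions in (2.1) restrict the variables
  B′ = (1/i) log V′ to a sufficiently small neighborhood of 0. A gauge transformation v of V induces the gauge
  transformation v of V^{(k)} and the transformation B′ → R(v)B′. The expressions in (2.1) are invariant with respect
  to these transformations.» — the fluctuation field `B′`, whose conditional mean is the (β)-node's insert, is a
  function of the RELATIVE variable `V′` alone: the shape `relInsert` (§1).
* [IV] (1.100)/(1.101) p. 201 (held text p0027 L15–L24): the basic large-field step integrates `dV′⌈_{Λ_i}` against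
  the window «χ(Λ_i) = χ({|(1/i) log V′(b)| < M₀ε_k for b ∈ Λ_i})» (reads `V′` alone: pv04's `relWindow`) and the
  action `A(ζ_i, U_{k,X_i}(V′_kV_{Λ_i}))` (reads `V′` THROUGH the background: pv04's `relDensity`).

DICTIONARY (as in `T4CondLawRelative`).  `s` = the integrated bond variables; `u u₀ V : GaugeField P j G` = the whole
field (fibre + exterior), `u₀` the reference exterior; `vΛ` with `FieldIndep s vΛ` = the background `V^{(k)}` / `V_Λ`
as a functional of the exterior; `y` = RAW fibre coordinates (`V⌈_s`), `y′ = y·(vΛ u)⌈_s⁻¹` = RELATIVE ones (`V′⌈_s`);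
`relDensity s vΛ old` = the density read in `V′` (pv04); `relInsert s vΛ f u` = an insert `f` of `V′⌈_s` read in the
raw coordinates of the fibre through `u` (NEW here); `tiltDom s (relDensity s vΛ old) u₀ κ ε ε₀` = the RELATIVE TILT
DOMAIN (pv16-g9's `tiltDom` applied to pv04's relative density: relative fibre densities ratio-close to those at `u₀`
with free constant `κ u` and oscillation `0 ≤ ε u ≤ ε₀`).

CONTENTS (every declaration [folklore] unless it models a printed shape; Mathlib + `T4TiltModulus` (pv16-g9),
`T4CondLawRelative` (pv04-g10), `T4DressingDefect` (pv04-g5), `T4FirstOrderSize` (pv16-g6), `T4CoReadMoment` (pv28-g4),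
`T4FibreTranslate` (b01) BY NAME).
* §1 relative inserts, algebra: `relInsert`, `relInsert_mul_onFibre` (exterior-independent in relative coordinates),
  `relInsert_one` (raw reading = the instance `vΛ ≡ 1`), `relWindow_updateFinset_eq_relInsert` (pv04's relative
  window IS a scalar relative insert), `tiltDom_relDensity_one`, `mem_tiltDom_relWindow_exp` (membership in the
  relative tilt domain for the printed Gibbs shape needs ONLY the exponent oscillation — pv04's
  `fibreRatioClose_relWindow_exp` BY NAME).
* §2 the fibre-level facts of `T4TiltModulus` §2 for the RELATIVE law from hypotheses on the RAW density:
  `measurable_fibreDensity_relDensity`, `integrable_fibreDensity_relDensity`, `integral_fibreDensity_relDensity_pos`,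
  `fibreIntegral_relDensity_ne_zero`, `isProbabilityMeasure_condLaw_relDensity`, and the D-FREE tilt modulus of the
  relative law `norm_integral_condLaw_relDensity_sub_le`.
* §3 the change of variables for relative inserts `integral_condLaw_relInsert` (+ `_apply`), `condMean_relWindow`,
  `pairMeanField_relInsert`, and the D-free modulus in the raw law `norm_integral_condLaw_relInsert_sub_le`.
* §4 dischargers BY NAME on the relative tilt domain: `meanLipschitz_of_tilt_relDensity`, `meanLipschitz_of_relTilt`,
  `condMeanSuppression_of_relTilt`, `pairMeanField_lipschitz_of_tilt_relDensity`, `pairMeanField_lipschitz_of_relTilt`,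
  `pairMeanField_norm_le_of_relTilt`; the D-CHARGED complement for inserts fixed in the raw variable
  `meanLipschitz_of_relTilt_raw` (pv04's `norm_integral_condLaw_sub_le_relative` BY NAME).
* §5 the printed shape `old = relWindow·e^{h}` assembled: `condMeanSuppression_relWindow_relInsert`, whose docstring
  lists the exact remaining inputs.
-/

noncomputable section

open _root_.MeasureTheory
open Function (updateFinset)
open scoped ENNReal

namespace Literature.MathematicalPhysics.QuantumFieldTheory.Balaban1983to89.T4TiltModulusRelative

open B15.BasicStep T4DressedR T4DressingDefect T4FirstOrderSize T4CoReadMoment T4FibreTranslate T4TiltModulus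
  T4CondLawRelative

section Fibre

variable {P : Params} {j : ℕ} {G : Type*} [GaugeGroup G] [MeasurableSpace G] [HaarData G]
variable [DecidableEq (PBond P j)]

/-! ## §1  Relative inserts (algebra) and the relative tilt domain -/

omit [MeasurableSpace G] [HaarData G] [DecidableEq (PBond P j)] in
/-- THE RELATIVE INSERT: an insert `f` of the RELATIVE fibre variable `V′⌈_s`, read in the RAW coordinates `y = V⌈_s`
of the fibre through the exterior `u`: `y ↦ f(y·(vΛ u)⌈_s⁻¹)` — the shape of an observable of the fluctuation field
«B′ = (1/i) log V′», «V′ = V(V^{(k)})^{−1}» ([I] p. 265).  In raw coordinates it DEPENDS ON THE EXTERIOR through the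
background; nothing is asserted about the printed `B′`. [cite: Balaban1987RG1, p.265] -/
def relInsert (s : Finset (PBond P j)) (vΛ : GaugeField P j G → GaugeField P j G) {α : Type*} (f : (s → G) → α)
    (u : GaugeField P j G) : (s → G) → α :=
  fun y => f (y * (onFibre s (vΛ u))⁻¹)

omit [MeasurableSpace G] [HaarData G] [DecidableEq (PBond P j)] in
/-- Unfolding lemma for the relative insert. [folklore] -/
@[simp] theorem relInsert_apply (s : Finset (PBond P j)) (vΛ : GaugeField P j G → GaugeField P j G) {α : Type*}
    (f : (s → G) → α) (u : GaugeField P j G) (y : s → G) :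
    relInsert s vΛ f u y = f (y * (onFibre s (vΛ u))⁻¹) := rfl

omit [MeasurableSpace G] [HaarData G] [DecidableEq (PBond P j)] in
/-- IN RELATIVE COORDINATES the relative insert is EXTERIOR-INDEPENDENT: `relInsert f u (y′·(vΛ u)⌈_s) = f y′` for every
exterior `u` (the insert twin of pv04's `relWindow_updateFinset_mul`). [folklore] -/
theorem relInsert_mul_onFibre (s : Finset (PBond P j)) (vΛ : GaugeField P j G → GaugeField P j G) {α : Type*}
    (f : (s → G) → α) (u : GaugeField P j G) (y : s → G) : relInsert s vΛ f u (y * onFibre s (vΛ u)) = f y := by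
  rw [relInsert_apply, mul_inv_cancel_right]

omit [MeasurableSpace G] [HaarData G] [DecidableEq (PBond P j)] in
/-- THE RAW READING IS THE INSTANCE `vΛ ≡ 1`: with the trivial background a relative insert is the insert (twin of
pv04's `relDensity_one`). [folklore] -/
theorem relInsert_one (s : Finset (PBond P j)) {α : Type*} (f : (s → G) → α) (u : GaugeField P j G) :
    relInsert s (fun _ => (1 : GaugeField P j G)) f u = f := by
  funext y
  rw [relInsert_apply]
  congr 1
  funext b
  show y b * ((1 : GaugeField P j G) b)⁻¹ = y b
  rw [show (1 : GaugeField P j G) b = 1 from rfl, inv_one, mul_one]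

omit [MeasurableSpace G] [HaarData G] in
/-- pv04's RELATIVE WINDOW IS A SCALAR RELATIVE INSERT: on the fibre through `V`,
`relWindow s vΛ w (V←y) = relInsert s vΛ w V y` (`T4CondLawRelative.relWindow_updateFinset`). [folklore] -/
theorem relWindow_updateFinset_eq_relInsert (s : Finset (PBond P j)) {vΛ : GaugeField P j G → GaugeField P j G}
    (hv : FieldIndep s vΛ) (w : (s → G) → ℝ) (V : GaugeField P j G) (y : s → G) :
    relWindow s vΛ w (updateFinset V s y) = relInsert s vΛ w V y :=
  (relWindow_updateFinset s hv w V y).trans rfl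

omit [MeasurableSpace G] [HaarData G] in
/-- SANITY — THE RAW TOY READING IS THE INSTANCE `vΛ ≡ 1` at the level of tilt domains:
`tiltDom s (relDensity s 1 old) = tiltDom s old` (pv04's `relDensity_one`), so every theorem below specialises to
`T4TiltModulus` §3. [folklore] -/
theorem tiltDom_relDensity_one (s : Finset (PBond P j)) (old : Density P j G) (u₀ : GaugeField P j G)
    (κ ε : GaugeField P j G → ℝ) (ε₀ : ℝ) :
    tiltDom s (relDensity s (fun _ => (1 : GaugeField P j G)) old) u₀ κ ε ε₀ = tiltDom s old u₀ κ ε ε₀ := by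
  rw [relDensity_one]

omit [MeasurableSpace G] [HaarData G] in
/-- MEMBERSHIP IN THE RELATIVE TILT DOMAIN FOR THE PRINTED SHAPE `old = relWindow·e^{h}` needs ONLY the oscillation of
the exponent along the relative fibre (`|h(u←y′·vΛ(u)⌈_s) − h(u₀←y′·vΛ(u₀)⌈_s) − κ u| ≤ ε u`, `0 ≤ ε u ≤ ε₀`): the
window hypothesis of (S-TILT) holds by construction (pv04's `fibreRatioClose_relWindow_exp` BY NAME).  The oscillation
itself is the (LOG) INPUT (pv28 lineage: `T4TiltOscillation`, G7-LOGREL*), not estimated here. [folklore] -/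
theorem mem_tiltDom_relWindow_exp (s : Finset (PBond P j)) {vΛ : GaugeField P j G → GaugeField P j G}
    (hv : FieldIndep s vΛ) {w : (s → G) → ℝ} (hw : ∀ y, 0 ≤ w y) {h : Density P j G} {u u₀ : GaugeField P j G}
    {κ ε : GaugeField P j G → ℝ} {ε₀ : ℝ}
    (hh : ∀ y : s → G,
      |h (updateFinset u s (y * onFibre s (vΛ u))) - h (updateFinset u₀ s (y * onFibre s (vΛ u₀))) - κ u| ≤ ε u)
    (hε0 : 0 ≤ ε u) (hε1 : ε u ≤ ε₀) :
    u ∈ tiltDom s (relDensity s vΛ fun U => relWindow s vΛ w U * Real.exp (h U)) u₀ κ ε ε₀ := by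
  rw [tiltDom, Set.mem_setOf_eq]
  exact ⟨fibreRatioClose_relWindow_exp s hv hw hh, hε0, hε1⟩

/-! ## §2  The fibre-level facts of `T4TiltModulus` §2 for the RELATIVE law, from hypotheses on the RAW density -/

variable [MeasurableMul G]

omit [HaarData G] in
/-- The fibre density of the RELATIVE density is measurable from measurability of the RAW density alone (it is the
raw fibre density composed with a right translation, pv04's `fibreDensity_relDensity`); no measurability of `vΛ`.
[folklore] -/
theorem measurable_fibreDensity_relDensity (s : Finset (PBond P j)) {vΛ : GaugeField P j G → GaugeField P j G}
    (hv : FieldIndep s vΛ) {old : Density P j G} (hm : Measurable old) (V : GaugeField P j G) :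
    Measurable (fibreDensity s (relDensity s vΛ old) V) := by
  rw [fibreDensity_relDensity s hv]
  exact (measurable_fibreDensity s hm V).comp (measurable_mul_const _)

/-- … integrable against the base law if `0 ≤ old ≤ C`. [folklore] -/
theorem integrable_fibreDensity_relDensity (s : Finset (PBond P j)) {vΛ : GaugeField P j G → GaugeField P j G}
    (hv : FieldIndep s vΛ) {old : Density P j G} (hm : Measurable old) (h0 : ∀ U, 0 ≤ old U) {C : ℝ}
    (hC : ∀ U, old U ≤ C) (V : GaugeField P j G) :
    Integrable (fibreDensity s (relDensity s vΛ old) V) (fibreBase s) :=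
  T4CoReadMoment.integrable_of_abs_le (measurable_fibreDensity_relDensity s hv hm V).aestronglyMeasurable (C := C)
    fun y => by
      rw [fibreDensity, abs_of_nonneg (relDensity_nonneg s vΛ h0 _)]
      exact relDensity_le s vΛ hC _

/-- … and of POSITIVE integral at the reference exterior under the printed proviso for the RAW density (right
invariance of the base law: `∫ fibreDensity (relDensity old) u₀ = ∫ fibreDensity old u₀ > 0`,
`T4TiltModulus.integral_fibreDensity_pos`). [folklore] -/
theorem integral_fibreDensity_relDensity_pos (s : Finset (PBond P j)) {vΛ : GaugeField P j G → GaugeField P j G}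
    (hv : FieldIndep s vΛ) {old : Density P j G} (hm : Measurable old) (h0 : ∀ U, 0 ≤ old U) {C : ℝ}
    (hC : ∀ U, old U ≤ C) {u₀ : GaugeField P j G} (hne : fibreIntegral s old u₀ ≠ 0) :
    0 < ∫ y, fibreDensity s (relDensity s vΛ old) u₀ y ∂fibreBase s :=
  calc (0 : ℝ) < ∫ y, fibreDensity s old u₀ y ∂fibreBase s := integral_fibreDensity_pos s hm h0 hC hne
    _ = ∫ y, fibreDensity s old u₀ (y * onFibre s (vΛ u₀)) ∂fibreBase s :=
        (integral_mul_right_eq_self (μ := fibreBase (P := P) (j := j) s) (fibreDensity s old u₀) _).symm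
    _ = ∫ y, fibreDensity s (relDensity s vΛ old) u₀ y ∂fibreBase s := by rw [fibreDensity_relDensity s hv]

/-- The printed proviso transports to the relative density: `fibreIntegral s (relDensity s vΛ old) u₀ ≠ 0` (pv04's
`fibreIntegral_relDensity`). [folklore] -/
theorem fibreIntegral_relDensity_ne_zero (s : Finset (PBond P j)) {vΛ : GaugeField P j G → GaugeField P j G}
    (hv : FieldIndep s vΛ) (old : Density P j G) {u₀ : GaugeField P j G} (hne : fibreIntegral s old u₀ ≠ 0) :
    fibreIntegral s (relDensity s vΛ old) u₀ ≠ 0 := by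
  rwa [fibreIntegral_relDensity s hv]

/-- … so the relative conditional law at `u₀` is a probability measure (pv04's `isProbabilityMeasure_condLaw`).
[folklore] -/
theorem isProbabilityMeasure_condLaw_relDensity (s : Finset (PBond P j)) {vΛ : GaugeField P j G → GaugeField P j G}
    (hv : FieldIndep s vΛ) {old : Density P j G} {C : ℝ} (hC : ∀ U, old U ≤ C) {u₀ : GaugeField P j G}
    (hne : fibreIntegral s old u₀ ≠ 0) : IsProbabilityMeasure (condLaw s (relDensity s vΛ old) u₀) :=
  isProbabilityMeasure_condLaw s (relDensity_le s vΛ hC) u₀ (fibreIntegral_relDensity_ne_zero s hv old hne)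

/-- **(T3-rel′) THE TILT MODULUS OF THE RELATIVE CONDITIONAL LAW — NO `D` TERM.**  For a measurable RAW density
`0 ≤ old ≤ C` with the printed proviso at `u₀`, a fibre-independent background `vΛ`, relative fibre densities
ratio-close (`FibreRatioClose s (relDensity s vΛ old) u u₀ κ ε`) and an insert `F` of the RELATIVE fibre variable,
a.e.-strongly measurable for the base law, with `‖F − c‖ ≤ M`:
`‖∫F ∂condLaw s (relDensity s vΛ old) u − ∫F ∂condLaw s (relDensity s vΛ old) u₀‖ ≤ (e^{2ε} − 1)·M` —
`T4TiltModulus` (T3) for the relative law with the hypotheses kept on the raw density (pv04-g10 proved this inline as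
the first half of `norm_integral_condLaw_sub_le_relative`; here it is the whole statement). [folklore] -/
theorem norm_integral_condLaw_relDensity_sub_le {E : Type*} [NormedAddCommGroup E] [NormedSpace ℝ E]
    [CompleteSpace E] (s : Finset (PBond P j)) {vΛ : GaugeField P j G → GaugeField P j G} (hv : FieldIndep s vΛ)
    {old : Density P j G} (hm : Measurable old) (h0 : ∀ U, 0 ≤ old U) {C : ℝ} (hC : ∀ U, old U ≤ C)
    {u u₀ : GaugeField P j G} (hne : fibreIntegral s old u₀ ≠ 0) {κ ε : ℝ}
    (hR : FibreRatioClose s (relDensity s vΛ old) u u₀ κ ε) {F : (s → G) → E}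
    (hF : AEStronglyMeasurable F (fibreBase s)) {c : E} {M : ℝ} (hM : ∀ y, ‖F y - c‖ ≤ M) :
    ‖(∫ y, F y ∂condLaw s (relDensity s vΛ old) u) - ∫ y, F y ∂condLaw s (relDensity s vΛ old) u₀‖
      ≤ (Real.exp (2 * ε) - 1) * M := by
  rw [condLaw_eq_normLaw, condLaw_eq_normLaw]
  exact norm_integral_normLaw_sub_le (measurable_fibreDensity_relDensity s hv hm u)
    (measurable_fibreDensity_relDensity s hv hm u₀) (fun y => relDensity_nonneg s vΛ h0 _)
    (integrable_fibreDensity_relDensity s hv hm h0 hC u) (integrable_fibreDensity_relDensity s hv hm h0 hC u₀)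
    (integral_fibreDensity_relDensity_pos s hv hm h0 hC hne) hR hF hM

/-! ## §3  The change of variables for relative inserts and the D-free tilt modulus in the raw law -/

/-- **INTEGRATING A RELATIVE INSERT = INTEGRATING AGAINST THE RELATIVE LAW:**
`∫ relInsert f u d(condLaw s old u) = ∫ f d(condLaw s (relDensity s vΛ old) u)` — pv04's change of variables
`integral_condLaw_eq_relative` followed by `y′·(vΛ u)⌈_s·((vΛ u)⌈_s)⁻¹ = y′`; on the right-hand side the insert no
longer depends on the exterior. [folklore] -/
theorem integral_condLaw_relInsert {E : Type*} [NormedAddCommGroup E] [NormedSpace ℝ E] (s : Finset (PBond P j))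
    {vΛ : GaugeField P j G → GaugeField P j G} (hv : FieldIndep s vΛ) (old : Density P j G) (u : GaugeField P j G)
    (f : (s → G) → E) :
    ∫ y, relInsert s vΛ f u y ∂condLaw s old u = ∫ y, f y ∂condLaw s (relDensity s vΛ old) u := by
  rw [integral_condLaw_eq_relative s hv old u (relInsert s vΛ f u)]
  simp only [relInsert_mul_onFibre]

/-- … for a bond-indexed family `B : (V′⌈_s) → β → E` of inserts of the relative variable: the exterior-indexed
conditional mean field of the relative inserts IS `T4TiltModulus`'s mean field of `B` under the relative law.
[folklore] -/
theorem integral_condLaw_relInsert_apply {E : Type*} [NormedAddCommGroup E] [NormedSpace ℝ E] {β : Type*}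
    (s : Finset (PBond P j)) {vΛ : GaugeField P j G → GaugeField P j G} (hv : FieldIndep s vΛ)
    (old : Density P j G) (B : (s → G) → β → E) (u : GaugeField P j G) (b : β) :
    ∫ y, relInsert s vΛ B u y b ∂condLaw s old u = ∫ y, B y b ∂condLaw s (relDensity s vΛ old) u :=
  integral_condLaw_relInsert s hv old u fun y => B y b

/-- THE SCALAR CASE IN pv04's VOCABULARY: the conditional mean `T4DressingDefect.condMean` of a density-type insert
READING THE RELATIVE VARIABLE ALONE (`relWindow s vΛ f`, the shape of an observable of `B′`) is the mean of `f` under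
the relative law. [folklore] -/
theorem condMean_relWindow (s : Finset (PBond P j)) {vΛ : GaugeField P j G → GaugeField P j G}
    (hv : FieldIndep s vΛ) (old : Density P j G) (f : (s → G) → ℝ) (V : GaugeField P j G) :
    condMean s old (relWindow s vΛ f) V = ∫ y, f y ∂condLaw s (relDensity s vΛ old) V := by
  rw [condMean]
  simp only [relWindow_updateFinset_eq_relInsert s hv]
  exact integral_condLaw_relInsert s hv old V f

/-- THE PAIR CASE (pv28-g4's `pairMeanField` of commutator inserts): the pair mean field of the relative inserts
under the raw law is the pair mean field of `B` under the relative law (the commutator is taken pointwise, so it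
commutes with the reading). [folklore] -/
theorem pairMeanField_relInsert {β : Type*} (s : Finset (PBond P j)) {vΛ : GaugeField P j G → GaugeField P j G}
    (hv : FieldIndep s vΛ) (old : Density P j G) (B : (s → G) → β → Fin 2 → Fin 2 → ℂ) (u : GaugeField P j G)
    (p : β × β) :
    pairMeanField (condLaw s old u) (relInsert s vΛ B u) p
      = pairMeanField (condLaw s (relDensity s vΛ old) u) B p :=
  integral_condLaw_relInsert s hv old u (mcomm (fun y => B y p.1) (fun y => B y p.2))

/-- **(T3-relins) THE TILT MODULUS IN THE RAW LAW FOR RELATIVE INSERTS — NO (B-INS) TERM.**  Same hypotheses as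
pv04's `norm_integral_condLaw_sub_le_relative` WITHOUT its background-variation input `hD`: for an insert `f` of the
relative variable with `‖f − c‖ ≤ M`,
`‖∫relInsert f u ∂condLaw s old u − ∫relInsert f u₀ ∂condLaw s old u₀‖ ≤ (e^{2ε} − 1)·M`.  (For an insert FIXED in
the raw variable pv04's `D` is genuinely owed — §4 `meanLipschitz_of_relTilt_raw`.) [folklore] -/
theorem norm_integral_condLaw_relInsert_sub_le {E : Type*} [NormedAddCommGroup E] [NormedSpace ℝ E]
    [CompleteSpace E] (s : Finset (PBond P j)) {vΛ : GaugeField P j G → GaugeField P j G} (hv : FieldIndep s vΛ)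
    {old : Density P j G} (hm : Measurable old) (h0 : ∀ U, 0 ≤ old U) {C : ℝ} (hC : ∀ U, old U ≤ C)
    {u u₀ : GaugeField P j G} (hne : fibreIntegral s old u₀ ≠ 0) {κ ε : ℝ}
    (hR : FibreRatioClose s (relDensity s vΛ old) u u₀ κ ε) {f : (s → G) → E}
    (hf : AEStronglyMeasurable f (fibreBase s)) {c : E} {M : ℝ} (hM : ∀ y, ‖f y - c‖ ≤ M) :
    ‖(∫ y, relInsert s vΛ f u y ∂condLaw s old u) - ∫ y, relInsert s vΛ f u₀ y ∂condLaw s old u₀‖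
      ≤ (Real.exp (2 * ε) - 1) * M := by
  rw [integral_condLaw_relInsert s hv, integral_condLaw_relInsert s hv]
  exact norm_integral_condLaw_relDensity_sub_le s hv hm h0 hC hne hR hf hM

/-! ## §4  Dischargers BY NAME on the relative tilt domain `tiltDom s (relDensity s vΛ old) u₀ κ ε ε₀` -/

/-- (T4-rel) `MeanLipschitz` FOR THE RELATIVE LAW: `T4TiltModulus.meanLipschitz_of_tilt` with `old` replaced by the
relative density and the hypotheses kept on the RAW density (no measurability of `vΛ`): for bond inserts
`y′ ↦ B y′ b` of the relative variable, a.e.-strongly measurable with `‖B y′ b − c b‖ ≤ M` on `S`, the mean field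
`u ↦ b ↦ ∫B(·) b ∂condLaw s (relDensity s vΛ old) u` is `MeanLipschitz` on the relative tilt domain with `dev := ε`,
`lip := 2e^{2ε₀}M`. [folklore] -/
theorem meanLipschitz_of_tilt_relDensity {E : Type*} [NormedAddCommGroup E] [NormedSpace ℝ E] [CompleteSpace E]
    {β : Type*} (s : Finset (PBond P j)) {vΛ : GaugeField P j G → GaugeField P j G} (hv : FieldIndep s vΛ)
    {old : Density P j G} (hm : Measurable old) (h0 : ∀ U, 0 ≤ old U) {C : ℝ} (hC : ∀ U, old U ≤ C)
    {u₀ : GaugeField P j G} (hne : fibreIntegral s old u₀ ≠ 0) {κ ε : GaugeField P j G → ℝ} {ε₀ : ℝ}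
    {B : (s → G) → β → E} {S : Finset β} (hB : ∀ b ∈ S, AEStronglyMeasurable (fun y => B y b) (fibreBase s))
    {c : β → E} {M : ℝ} (hM : ∀ b ∈ S, ∀ y, ‖B y b - c b‖ ≤ M) :
    MeanLipschitz (tiltDom s (relDensity s vΛ old) u₀ κ ε ε₀)
      (fun u b => ∫ y, B y b ∂condLaw s (relDensity s vΛ old) u) S u₀ ε (2 * Real.exp (2 * ε₀) * M) := by
  intro u hu b hb
  obtain ⟨hR, hε0, hε1⟩ := hu
  have hMnn : 0 ≤ M := (norm_nonneg _).trans (hM b hb (fun _ => 1))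
  calc ‖(∫ y, B y b ∂condLaw s (relDensity s vΛ old) u) - ∫ y, B y b ∂condLaw s (relDensity s vΛ old) u₀‖
        ≤ (Real.exp (2 * ε u) - 1) * M :=
          norm_integral_condLaw_relDensity_sub_le s hv hm h0 hC hne hR (hB b hb) (hM b hb)
    _ ≤ 2 * Real.exp (2 * ε₀) * ε u * M := mul_le_mul_of_nonneg_right (exp_two_mul_sub_one_le hε0 hε1) hMnn
    _ = 2 * Real.exp (2 * ε₀) * M * ε u := by ring

/-- **(T4-relins) `MeanLipschitz` FOR RELATIVE INSERTS UNDER THE RAW LAW — THE (β)-NODE'S SHAPE, NO (B-INS) CHARGE.**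
Same data; the exterior-indexed conditional mean field of the relative inserts,
`u ↦ b ↦ ∫ relInsert B u (·) b ∂condLaw s old u` (the model of `E[B(V′⌈_s) b | V_out = u]` for an observable `B` of the
relative variable), is `MeanLipschitz` on the relative tilt domain with `dev := ε` and the SAME `lip := 2e^{2ε₀}M` as
`T4TiltModulus.meanLipschitz_of_tilt`. [folklore] -/
theorem meanLipschitz_of_relTilt {E : Type*} [NormedAddCommGroup E] [NormedSpace ℝ E] [CompleteSpace E]
    {β : Type*} (s : Finset (PBond P j)) {vΛ : GaugeField P j G → GaugeField P j G} (hv : FieldIndep s vΛ)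
    {old : Density P j G} (hm : Measurable old) (h0 : ∀ U, 0 ≤ old U) {C : ℝ} (hC : ∀ U, old U ≤ C)
    {u₀ : GaugeField P j G} (hne : fibreIntegral s old u₀ ≠ 0) {κ ε : GaugeField P j G → ℝ} {ε₀ : ℝ}
    {B : (s → G) → β → E} {S : Finset β} (hB : ∀ b ∈ S, AEStronglyMeasurable (fun y => B y b) (fibreBase s))
    {c : β → E} {M : ℝ} (hM : ∀ b ∈ S, ∀ y, ‖B y b - c b‖ ≤ M) :
    MeanLipschitz (tiltDom s (relDensity s vΛ old) u₀ κ ε ε₀)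
      (fun u b => ∫ y, relInsert s vΛ B u y b ∂condLaw s old u) S u₀ ε (2 * Real.exp (2 * ε₀) * M) := by
  intro u hu b hb
  have h := meanLipschitz_of_tilt_relDensity s hv hm h0 hC hne hB hM u hu b hb
  simpa only [integral_condLaw_relInsert_apply s hv] using h

/-- (T4-relins) … hence, with `MeanVanishes` at the reference exterior (row O3.E-i′ (α)/K — NOT touched here), pv16's
`CondMeanSuppression` of the relative inserts on the relative tilt domain (`condMeanSuppression_of_flat`).
[folklore] -/
theorem condMeanSuppression_of_relTilt {E : Type*} [NormedAddCommGroup E] [NormedSpace ℝ E] [CompleteSpace E]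
    {β : Type*} (s : Finset (PBond P j)) {vΛ : GaugeField P j G → GaugeField P j G} (hv : FieldIndep s vΛ)
    {old : Density P j G} (hm : Measurable old) (h0 : ∀ U, 0 ≤ old U) {C : ℝ} (hC : ∀ U, old U ≤ C)
    {u₀ : GaugeField P j G} (hne : fibreIntegral s old u₀ ≠ 0) {κ ε : GaugeField P j G → ℝ} {ε₀ : ℝ}
    {B : (s → G) → β → E} {S : Finset β} (hB : ∀ b ∈ S, AEStronglyMeasurable (fun y => B y b) (fibreBase s))
    {c : β → E} {M : ℝ} (hM : ∀ b ∈ S, ∀ y, ‖B y b - c b‖ ≤ M)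
    (hflat : MeanVanishes S fun b => ∫ y, relInsert s vΛ B u₀ y b ∂condLaw s old u₀) :
    CondMeanSuppression (tiltDom s (relDensity s vΛ old) u₀ κ ε ε₀)
      (fun u b => ∫ y, relInsert s vΛ B u y b ∂condLaw s old u) S ε (2 * Real.exp (2 * ε₀) * M) :=
  condMeanSuppression_of_flat (hL := meanLipschitz_of_relTilt s hv hm h0 hC hne hB hM) hflat

/-- (T4-rel) THE PAIR-MEAN LIPSCHITZ BINDER FOR THE RELATIVE LAW (`T4TiltModulus.pairMeanField_lipschitz_of_tilt` with
the relative density, hypotheses on the raw density). [folklore] -/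
theorem pairMeanField_lipschitz_of_tilt_relDensity {β : Type*} (s : Finset (PBond P j))
    {vΛ : GaugeField P j G → GaugeField P j G} (hv : FieldIndep s vΛ) {old : Density P j G} (hm : Measurable old)
    (h0 : ∀ U, 0 ≤ old U) {C : ℝ} (hC : ∀ U, old U ≤ C) {u₀ : GaugeField P j G}
    (hne : fibreIntegral s old u₀ ≠ 0) {κ ε : GaugeField P j G → ℝ} {ε₀ : ℝ}
    {B : (s → G) → β → Fin 2 → Fin 2 → ℂ} {S : Finset (β × β)}
    (hB : ∀ p ∈ S, AEStronglyMeasurable (mcomm (fun y => B y p.1) (fun y => B y p.2)) (fibreBase s))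
    {c : β × β → Fin 2 → Fin 2 → ℂ} {M : ℝ}
    (hM : ∀ p ∈ S, ∀ y, ‖mcomm (fun y => B y p.1) (fun y => B y p.2) y - c p‖ ≤ M) :
    ∀ u ∈ tiltDom s (relDensity s vΛ old) u₀ κ ε ε₀, ∀ p ∈ S,
      ‖pairMeanField (condLaw s (relDensity s vΛ old) u) B p
          - pairMeanField (condLaw s (relDensity s vΛ old) u₀) B p‖ ≤ 2 * Real.exp (2 * ε₀) * M * ε u := by
  intro u hu p hp
  obtain ⟨hR, hε0, hε1⟩ := hu
  have hMnn : 0 ≤ M := (norm_nonneg _).trans (hM p hp (fun _ => 1))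
  calc ‖pairMeanField (condLaw s (relDensity s vΛ old) u) B p
          - pairMeanField (condLaw s (relDensity s vΛ old) u₀) B p‖ ≤ (Real.exp (2 * ε u) - 1) * M :=
        norm_integral_condLaw_relDensity_sub_le s hv hm h0 hC hne hR (hB p hp) (hM p hp)
    _ ≤ 2 * Real.exp (2 * ε₀) * ε u * M := mul_le_mul_of_nonneg_right (exp_two_mul_sub_one_le hε0 hε1) hMnn
    _ = 2 * Real.exp (2 * ε₀) * M * ε u := by ring

/-- **(T4-relins) THE PAIR-MEAN LIPSCHITZ BINDER FOR RELATIVE COMMUTATOR INSERTS UNDER THE RAW LAW** — the hypothesis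
`hL` of `T4CoReadMoment.pairMean_norm_le_of_lipschitz` for `u ↦ pairMeanField (condLaw s old u) (relInsert s vΛ B u)`,
with `dev := ε`, `lip := 2e^{2ε₀}M` and no (B-INS) charge. [folklore] -/
theorem pairMeanField_lipschitz_of_relTilt {β : Type*} (s : Finset (PBond P j))
    {vΛ : GaugeField P j G → GaugeField P j G} (hv : FieldIndep s vΛ) {old : Density P j G} (hm : Measurable old)
    (h0 : ∀ U, 0 ≤ old U) {C : ℝ} (hC : ∀ U, old U ≤ C) {u₀ : GaugeField P j G}
    (hne : fibreIntegral s old u₀ ≠ 0) {κ ε : GaugeField P j G → ℝ} {ε₀ : ℝ}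
    {B : (s → G) → β → Fin 2 → Fin 2 → ℂ} {S : Finset (β × β)}
    (hB : ∀ p ∈ S, AEStronglyMeasurable (mcomm (fun y => B y p.1) (fun y => B y p.2)) (fibreBase s))
    {c : β × β → Fin 2 → Fin 2 → ℂ} {M : ℝ}
    (hM : ∀ p ∈ S, ∀ y, ‖mcomm (fun y => B y p.1) (fun y => B y p.2) y - c p‖ ≤ M) :
    ∀ u ∈ tiltDom s (relDensity s vΛ old) u₀ κ ε ε₀, ∀ p ∈ S,
      ‖pairMeanField (condLaw s old u) (relInsert s vΛ B u) p
          - pairMeanField (condLaw s old u₀) (relInsert s vΛ B u₀) p‖ ≤ 2 * Real.exp (2 * ε₀) * M * ε u := by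
  intro u hu p hp
  rw [pairMeanField_relInsert s hv, pairMeanField_relInsert s hv]
  exact pairMeanField_lipschitz_of_tilt_relDensity s hv hm h0 hC hne hB hM u hu p hp

/-- (T4-relins) … hence, with zero pair mean at the reference exterior (K9 — NOT touched here), the pair-mean
SUPPRESSION of the relative commutator inserts on the relative tilt domain (`pairMean_norm_le_of_lipschitz`).
[folklore] -/
theorem pairMeanField_norm_le_of_relTilt {β : Type*} (s : Finset (PBond P j))
    {vΛ : GaugeField P j G → GaugeField P j G} (hv : FieldIndep s vΛ) {old : Density P j G} (hm : Measurable old)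
    (h0 : ∀ U, 0 ≤ old U) {C : ℝ} (hC : ∀ U, old U ≤ C) {u₀ : GaugeField P j G}
    (hne : fibreIntegral s old u₀ ≠ 0) {κ ε : GaugeField P j G → ℝ} {ε₀ : ℝ}
    {B : (s → G) → β → Fin 2 → Fin 2 → ℂ} {S : Finset (β × β)}
    (hB : ∀ p ∈ S, AEStronglyMeasurable (mcomm (fun y => B y p.1) (fun y => B y p.2)) (fibreBase s))
    {c : β × β → Fin 2 → Fin 2 → ℂ} {M : ℝ}
    (hM : ∀ p ∈ S, ∀ y, ‖mcomm (fun y => B y p.1) (fun y => B y p.2) y - c p‖ ≤ M)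
    (hflat : ∀ p ∈ S, pairMeanField (condLaw s old u₀) (relInsert s vΛ B u₀) p = 0) :
    ∀ u ∈ tiltDom s (relDensity s vΛ old) u₀ κ ε ε₀, ∀ p ∈ S,
      ‖pairMeanField (condLaw s old u) (relInsert s vΛ B u) p‖ ≤ 2 * Real.exp (2 * ε₀) * M * ε u :=
  pairMean_norm_le_of_lipschitz (m₂ := fun u => pairMeanField (condLaw s old u) (relInsert s vΛ B u)) hflat
    (pairMeanField_lipschitz_of_relTilt s hv hm h0 hC hne hB hM)

/-- (T4-rel-raw) THE D-CHARGED COMPLEMENT — INSERTS FIXED IN THE RAW VARIABLE.  For bond inserts `y ↦ B y b` that do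
NOT move with the background (exterior-independent in RAW coordinates: the shape of
`T4TiltModulus.meanLipschitz_of_tilt`), ratio-closeness in relative coordinates still yields `MeanLipschitz` on the
relative tilt domain, but with pv04's
background-variation input: if `‖B(y′·(vΛ u)⌈_s) b − B(y′·(vΛ u₀)⌈_s) b‖ ≤ L·ε u` on the domain, then
`lip := 2e^{2ε₀}M + L` (`T4CondLawRelative.norm_integral_condLaw_sub_le_relative` BY NAME).  The modulus `L` (a
Lipschitz constant of `B` times a bound of the background displacement `(vΛ u)⌈_s` vs `(vΛ u₀)⌈_s` by `ε u`) is an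
INPUT typed nowhere in the tree. [folklore] -/
theorem meanLipschitz_of_relTilt_raw {E : Type*} [NormedAddCommGroup E] [NormedSpace ℝ E] [CompleteSpace E]
    {β : Type*} (s : Finset (PBond P j)) {vΛ : GaugeField P j G → GaugeField P j G} (hv : FieldIndep s vΛ)
    {old : Density P j G} (hm : Measurable old) (h0 : ∀ U, 0 ≤ old U) {C : ℝ} (hC : ∀ U, old U ≤ C)
    {u₀ : GaugeField P j G} (hne : fibreIntegral s old u₀ ≠ 0) {κ ε : GaugeField P j G → ℝ} {ε₀ : ℝ}
    {B : (s → G) → β → E} {S : Finset β} (hB : ∀ b ∈ S, AEStronglyMeasurable (fun y => B y b) (fibreBase s))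
    {c : β → E} {M L : ℝ} (hM : ∀ b ∈ S, ∀ y, ‖B y b - c b‖ ≤ M)
    (hD : ∀ u ∈ tiltDom s (relDensity s vΛ old) u₀ κ ε ε₀, ∀ b ∈ S, ∀ y : s → G,
      ‖B (y * onFibre s (vΛ u)) b - B (y * onFibre s (vΛ u₀)) b‖ ≤ L * ε u) :
    MeanLipschitz (tiltDom s (relDensity s vΛ old) u₀ κ ε ε₀) (fun u b => ∫ y, B y b ∂condLaw s old u) S u₀ ε
      (2 * Real.exp (2 * ε₀) * M + L) := by
  intro u hu b hb
  have hD' := hD u hu b hb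
  obtain ⟨hR, hε0, hε1⟩ := hu
  have hMnn : 0 ≤ M := (norm_nonneg _).trans (hM b hb (fun _ => 1))
  calc ‖(∫ y, B y b ∂condLaw s old u) - ∫ y, B y b ∂condLaw s old u₀‖
        ≤ (Real.exp (2 * ε u) - 1) * M + L * ε u :=
          norm_integral_condLaw_sub_le_relative s hv hm h0 hC hne hR (hB b hb) (hM b hb) hD'
    _ ≤ 2 * Real.exp (2 * ε₀) * ε u * M + L * ε u :=
          add_le_add (mul_le_mul_of_nonneg_right (exp_two_mul_sub_one_le hε0 hε1) hMnn) le_rfl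
    _ = (2 * Real.exp (2 * ε₀) * M + L) * ε u := by ring

/-! ## §5  The printed shape `old = relWindow·e^{h}` assembled -/

/-- **THE PRINTED SHAPE, ASSEMBLED.**  For a density of the Gibbs form `old = χ·e^{h}` whose window READS THE RELATIVE
VARIABLE ALONE (`χ = relWindow s vΛ w`, the shape of (1.101) [IV] and of `χ_k` in [I] p. 265) and inserts reading the
relative variable alone (`relInsert`, the shape of observables of `B′`, [I] p. 265), `CondMeanSuppression` on the
relative tilt domain holds with `lip = 2e^{2ε₀}M` from EXACTLY these inputs: (i) `FieldIndep s vΛ` (shape of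
`V^{(k)}` / `V_Λ`; U1a / B12-side); (ii) measurability of the modelled density and bounds `0 ≤ w ≤ C_w`, `h ≤ H`
(model bookkeeping); (iii) the printed proviso `fibreIntegral ≠ 0` at `u₀`; (iv) `MeanVanishes` at `u₀` (row (α)/K);
(v) a.e.-strong measurability and bounded oscillation `M` of the inserts; and — the ONLY estimate — (vi) membership
`u ∈ tiltDom …`, i.e. the oscillation `ε u` of the exponent along the relative fibre (`mem_tiltDom_relWindow_exp`; the
(LOG) input of the pv28 lineage).  NO window-blindness hypothesis (pv04: by construction) and NO background-variation
term `D` (this module).  Nothing printed is asserted. [folklore] -/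
theorem condMeanSuppression_relWindow_relInsert {E : Type*} [NormedAddCommGroup E] [NormedSpace ℝ E]
    [CompleteSpace E] {β : Type*} (s : Finset (PBond P j)) {vΛ : GaugeField P j G → GaugeField P j G}
    (hv : FieldIndep s vΛ) {w : (s → G) → ℝ} {h : Density P j G}
    (hm : Measurable fun U => relWindow s vΛ w U * Real.exp (h U)) (hw0 : ∀ y, 0 ≤ w y) {Cw H : ℝ}
    (hwC : ∀ y, w y ≤ Cw) (hH : ∀ U, h U ≤ H) {u₀ : GaugeField P j G}
    (hne : fibreIntegral s (fun U => relWindow s vΛ w U * Real.exp (h U)) u₀ ≠ 0)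
    {κ ε : GaugeField P j G → ℝ} {ε₀ : ℝ} {B : (s → G) → β → E} {S : Finset β}
    (hB : ∀ b ∈ S, AEStronglyMeasurable (fun y => B y b) (fibreBase s)) {c : β → E} {M : ℝ}
    (hM : ∀ b ∈ S, ∀ y, ‖B y b - c b‖ ≤ M)
    (hflat : MeanVanishes S fun b =>
      ∫ y, relInsert s vΛ B u₀ y b ∂condLaw s (fun U => relWindow s vΛ w U * Real.exp (h U)) u₀) :
    CondMeanSuppression (tiltDom s (relDensity s vΛ fun U => relWindow s vΛ w U * Real.exp (h U)) u₀ κ ε ε₀)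
      (fun u b => ∫ y, relInsert s vΛ B u y b ∂condLaw s (fun U => relWindow s vΛ w U * Real.exp (h U)) u) S ε
      (2 * Real.exp (2 * ε₀) * M) :=
  condMeanSuppression_of_relTilt s hv hm (fun _ => mul_nonneg (hw0 _) (Real.exp_pos _).le) (C := Cw * Real.exp H)
    (fun U => mul_le_mul (hwC _) (Real.exp_le_exp.mpr (hH U)) (Real.exp_pos _).le
      ((hw0 fun _ => 1).trans (hwC fun _ => 1)))
    hne hB hM hflat

end Fibre

end Literature.MathematicalPhysics.QuantumFieldTheory.Balaban1983to89.T4TiltModulusRelative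

end
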